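import Literature.Combinatorics.Sahi2008.KahnFixedPointExample
import Literature.Combinatorics.Sahi2008.KahnFUINotFKG
import Literature.Combinatorics.Sahi2008.UnderlyingIndependents
import Literature.Combinatorics.Sahi2008.Percolation
import Literature.Probability.LatticeModels.StrongHarrisKleitman
import HarnessLib

/-!
# Kahn's Question 1 ("are all PA measures UI?") answered: Gladkov's strong FKG inequality for FUI/UI
# laws (Bull. LMS 2024, Thm 3.2) and `µ₃` is NOT UI (Thm 3.5)

CITATION HEADER.  Sources, read from the materialised texts:
* J. Kahn, *A note on positive association*, arXiv:2210.08653 (2022) [Kahn2022], p. 2 (verbatim): "One way to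
  prove PA for `µ` is to realize the `X_i`'s as increasing functions of independent Bernoullis `Y_1,…,Y_m` and
  invoke Harris; more generally, `µ` is PA if it is a limit of measures obtained in this way.  Say `µ` is FUI
  (for finitely many underlying independents) in the first case, and UI in the second. … (2) are all PA measures
  FUI?  As we will see shortly, the answer is no; but, remarkably, we can't (as far as I know) rule out a slightly
  weaker possibility: **Question 1.** Are all PA measures UI?"; p. 3: "so a positive answer to Question 1, even
  just for `µ_3`, would say Sahi's Conjecture … is false."
* N. Gladkov, *A strong FKG inequality for multiple events*, Bull. Lond. Math. Soc. 56 (2024),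
  doi:10.1112/blms.13101 = arXiv:2305.02653 [Gladkov2024StrongFKG], §3 (verbatim): "Measure `µ` on `H_n` is
  called FUI …, if there is a realization of `X_i`'s as increasing functions of independent Bernoulli random
  variables `Y_1, …, Y_m` for some `m`.  Measure `µ` is called UI, if it is a limit of FUI measures on the same
  hypercube. … **Theorem 3.2.** Let `µ` be a UI measure on `H_n`, and `H_n = A ⊔ C_1 ⊔ C_2 ⊔ ⋯ ⊔ C_k ⊔ B` for
  `k ≥ 2` such that all sets of the form `A ∪ C_i` are closed upwards.  Then `µ(A)µ(B) ≥ e_2(µ(C_1), …, µ(C_k))`.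
  *Proof.* Suppose `µ` is an FUI measure … All sets `A ∪ C_j` are closed upwards in the hypercube generated by
  `Y_i`'s, so by Theorem 2.1 we have [the inequality].  For UI measures, [it] is obtained as a limit of
  inequalities for FUI measures. … **Theorem 3.5.** There are measures on `H_n` with positive associations
  which are not UI.  *Proof.* Note that `µ_3({1}) = µ_3({2}) = µ_3({3}) = µ_3({1,2,3}) = 1/6` and `µ_3(∅) = 1/3`.
  Consider `A = {|S| ≥ 2}`, `B = {S = ∅}`, `C_i = {S = {i}}` for `1 ≤ i ≤ 3`.  Suppose `µ_3` is UI.  Then by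
  Theorem 3.2 we have `1/18 ≥ e_2(1/6, 1/6, 1/6) = 1/12`, a contradiction.  Thus `µ_3` is not UI, as desired."
  ("This answers a question dating back to at least 2002 [Kahn2022].")

Theorem 2.1 itself (product measures) is the tree's `Literature.Probability.LatticeModels.prodBernoulli_strongHarris`
(`StrongHarrisKleitman.lean`), written there as `(Σ µ(C_i))² − Σ µ(C_i)² ≤ 2µ(A)µ(B)` with `B := (A ∪ ⋃ C_i)ᶜ`;
`µ_3` is the tree's `Kahn2022.mu3` (`KahnFixedPointExample.lean`, where it is shown PA and not FUI = Kahn's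
Corollary 4).

What is here (everything PROVED; two predicate `def`s naming Kahn's classes, no named fact):
* `Kahn2022.IsFUI ν` — `ν` is the image of a product measure on finitely many coins under a monotone map
  ("FUI"); `Kahn2022.IsUI ν` — `ν` is a limit of FUI laws on the same (finite) cube, i.e. some sequence of FUI
  laws converges to `ν` on every event ("UI"); `IsFUI.isUI`; `IsFUI.isPositivelyAssociated`,
  `IsUI.isPositivelyAssociated` (Harris; "µ is PA if it is a limit of measures obtained in this way");
  (appended) `IsUI.isProbabilityMeasure`, `IsFUI.map`, `IsUI.map` (both classes are closed under monotone maps);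
* **`Kahn2022.IsFUI.strongHarris`**, **`Kahn2022.IsUI.strongHarris`** — Gladkov's Theorem 3.2 (FKG+) for FUI
  and for UI laws, in the tree's `2e_2` form, by pulling the partition back along the monotone map to the coin
  cube (`prodBernoulli_strongHarris`) and passing to the limit;
* `Kahn2022.mu3_violates_strongHarris` — the displayed computation for `µ_3` (`1/6 > 1/9`, i.e. `1/18 < 1/12`);
* **`Kahn2022.mu3_not_isUI`** — Theorem 3.5: `µ_3` is not UI; **`Kahn2022.question1_negative`** — there is a
  positively associated probability measure on `2^{[3]}` that is not UI (Kahn's Question 1 answered in the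
  negative; with it the route "Question 1 for `µ_3` ⇒ Sahi's conjecture false" of [Kahn2022, p. 3] is closed).
* (appended) **`Kahn2022.isFUI_of_isFKGMeasure`** — Kahn's footnote 1 / Gladkov's Prop. 3.1 ("All measures `µ`
  with the FKG property are FUI") at MEASURE level: a finite measure on `2^W` whose point weights form an FKG
  probability weight (`IsFKGMeasure`, `Functional.lean`) is `IsFUI` — the weight-level representation
  `IsFKGMeasure.exists_coinRepresentation` (`UnderlyingIndependents.lean`) transported to `prodBernoulli` through the
  Boolean-coordinates equivalence `setCube`; `Kahn2022.isFUI_prodBernoulli` (product measures are FUI);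
  **`Kahn2022.strongHarris_of_isFKGMeasure`** — Gladkov's Theorem 3.2 for FKG measures ("In particular, it holds
  for all measures with the FKG property").
* (appended) **`Kahn2022.IsFUI.sahiE3_nonneg_of_forall_prodBernoulli`**, **`Kahn2022.IsUI.sahiE3_nonneg_of_forall_prodBernoulli`**
  — Kahn's remark (p. 3) "Sahi's Conjecture—which of course also implies (4) when `µ` is UI": if (4) = `E₃ ≥ 0`
  (tree `sahiE3`) holds for all increasing events under every product measure on a finite cube (Kahn's
  Conjecture 5, taken as a HYPOTHESIS), then it holds for all increasing events under every FUI law (pull back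
  along the monotone map) and every UI law (limit); nothing here asserts Conjecture 5.

## References
* N. Gladkov, *A strong FKG inequality for multiple events*, Bull. Lond. Math. Soc. 56 (2024), Thms 3.2, 3.5. [Gladkov2024StrongFKG]
* J. Kahn, *A note on positive association*, arXiv:2210.08653 (2022), p. 2 (FUI, UI, Question 1), p. 3. [Kahn2022]
-/

noncomputable section

open MeasureTheory Measure Set Filter Topology
open Literature.Probability.LatticeModels (prodBernoulli prodBernoulli_strongHarris sahiE3 sahiE3_def)
open Literature.Probability.Percolation (IsPositivelyAssociated isPositivelyAssociated_of_real)

namespace Literature.Combinatorics.Sahi2008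

namespace Kahn2022

variable {W : Type*}

/-! ### FUI and UI laws on a finite cube `2^W` -/

/-- **FUI** ("finitely many underlying independents"): `ν` is the law of a MONOTONE function of finitely many
independent coins — the image of a product measure `prodBernoulli q` on a finite cube `2^κ` under a monotone
`Φ : 2^κ → 2^W`. [cite: Kahn2022, p. 2 ("Underlying independents"); Gladkov2024StrongFKG, §3] -/
def IsFUI (ν : Measure (Set W)) : Prop :=
  ∃ (κ : Type) (_ : Fintype κ) (q : κ → unitInterval) (Φ : Set κ → Set W), Monotone Φ ∧ ν = (prodBernoulli q).map Φ

/-- **UI** ("underlying independents"): `ν` is a limit of FUI laws on the same cube — some sequence of FUI laws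
converges to `ν` on every event (on a finite cube all the usual topologies agree).
[cite: Kahn2022, p. 2; Gladkov2024StrongFKG, §3 ("a limit of FUI measures on the same hypercube")] -/
def IsUI (ν : Measure (Set W)) : Prop :=
  ∃ νs : ℕ → Measure (Set W), (∀ n, IsFUI (νs n)) ∧
    ∀ E : Set (Set W), Tendsto (fun n => (νs n).real E) atTop (𝓝 (ν.real E))

/-- FUI laws are UI (constant sequence). [cite: Kahn2022, p. 2] -/
theorem IsFUI.isUI {ν : Measure (Set W)} (h : IsFUI ν) : IsUI ν :=
  ⟨fun _ => ν, fun _ => h, fun _ => tendsto_const_nhds⟩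

/-- An FUI law is a probability measure. [cite: Kahn2022, p. 2] -/
theorem IsFUI.isProbabilityMeasure {ν : Measure (Set W)} (h : IsFUI ν) : IsProbabilityMeasure ν := by
  obtain ⟨κ, _, q, Φ, -, rfl⟩ := h
  exact isProbabilityMeasure_map (Measurable.of_discrete (f := Φ)).aemeasurable

/-- **FUI ⇒ PA** ("realize the `X_i`'s as increasing functions of independent Bernoullis … and invoke Harris").
[cite: Kahn2022, p. 2] -/
theorem IsFUI.isPositivelyAssociated {ν : Measure (Set W)} (h : IsFUI ν) : IsPositivelyAssociated ν := by
  obtain ⟨κ, _, q, Φ, hΦ, rfl⟩ := h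
  exact (isPositivelyAssociated_prodBernoulli q).map hΦ Measurable.of_discrete

/-- **UI ⇒ PA** ("more generally, `µ` is PA if it is a limit of measures obtained in this way"): positive
correlation of two up-sets passes to the limit. [cite: Kahn2022, p. 2] -/
theorem IsUI.isPositivelyAssociated {ν : Measure (Set W)} [IsFiniteMeasure ν] (h : IsUI ν) :
    IsPositivelyAssociated ν := by
  obtain ⟨νs, hF, hlim⟩ := h
  refine isPositivelyAssociated_of_real fun A B hA hB hAm hBm => ?_
  have h1 : Tendsto (fun n => (νs n).real A * (νs n).real B) atTop (𝓝 (ν.real A * ν.real B)) :=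
    (hlim A).mul (hlim B)
  have h2 : Tendsto (fun n => (νs n).real (A ∩ B)) atTop (𝓝 (ν.real (A ∩ B))) := hlim (A ∩ B)
  refine le_of_tendsto_of_tendsto' h1 h2 fun n => ?_
  haveI := (hF n).isProbabilityMeasure
  exact (hF n).isPositivelyAssociated.real hA hB hAm hBm

/-- A UI law is a probability measure (limit of the total masses `1`). [cite: Kahn2022, p. 2] -/
theorem IsUI.isProbabilityMeasure {ν : Measure (Set W)} (h : IsUI ν) : IsProbabilityMeasure ν := by
  obtain ⟨νs, hF, hlim⟩ := h
  have h1 : Tendsto (fun n => (νs n).real Set.univ) atTop (𝓝 (ν.real Set.univ)) := hlim _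
  have h2 : (fun n => (νs n).real Set.univ) = fun _ => (1 : ℝ) := by
    funext n
    haveI := (hF n).isProbabilityMeasure
    exact probReal_univ
  rw [h2] at h1
  have h3 : ν.real Set.univ = 1 := (tendsto_nhds_unique tendsto_const_nhds h1).symm
  have h4 : ν Set.univ = 1 := by
    have hne : ν Set.univ ≠ ⊤ := by
      intro htop
      rw [measureReal_def, htop, ENNReal.toReal_top] at h3
      exact zero_ne_one h3
    rw [measureReal_def] at h3
    rw [← ENNReal.ofReal_toReal hne, h3, ENNReal.ofReal_one]
  exact ⟨h4⟩

/-- **FUI is closed under monotone maps** ("realize the `X_i`'s as increasing functions of …"): a monotone image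
of an FUI law is FUI. [cite: Kahn2022, p. 2 ("Underlying independents")] -/
theorem IsFUI.map {W' : Type*} {ν : Measure (Set W)} (h : IsFUI ν) {Ψ : Set W → Set W'} (hΨ : Monotone Ψ)
    (hΨm : Measurable Ψ) : IsFUI (ν.map Ψ) := by
  obtain ⟨κ, _, q, Φ, hΦ, rfl⟩ := h
  refine ⟨κ, inferInstance, q, Ψ ∘ Φ, hΨ.comp hΦ, ?_⟩
  rw [Measure.map_map hΨm Measurable.of_discrete]

/-! ### Gladkov's Theorem 3.2: the strong FKG inequality for FUI and UI laws -/

variable [Fintype W]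

/-- **UI is closed under monotone maps** between finite cubes: setwise convergence is preserved under
preimages. [cite: Kahn2022, p. 2 ("a limit of measures obtained in this way")] -/
theorem IsUI.map {W' : Type*} [Fintype W'] {ν : Measure (Set W)} (h : IsUI ν) {Ψ : Set W → Set W'}
    (hΨ : Monotone Ψ) : IsUI (ν.map Ψ) := by
  obtain ⟨νs, hF, hlim⟩ := h
  have hΨm : Measurable Ψ := Measurable.of_discrete
  refine ⟨fun n => (νs n).map Ψ, fun n => (hF n).map hΨ hΨm, fun E => ?_⟩
  have e : ∀ μ : Measure (Set W), (μ.map Ψ).real E = μ.real (Ψ ⁻¹' E) :=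
    fun μ => map_measureReal_apply hΨm MeasurableSet.of_discrete
  simp only [e]
  exact hlim _

/-- **Gladkov 2024, Theorem 3.2, FUI case.**  For an FUI law `ν` on `2^W`, cells `C i` (`i ∈ s`) pairwise disjoint
and disjoint from the up-set `A`, with every `A ∪ C i` closed upwards, and `B := (A ∪ ⋃ C i)ᶜ`:
`(Σ ν(C i))² − Σ ν(C i)² ≤ 2 ν(A) ν(B)`, i.e. `ν(A)ν(B) ≥ e_2(ν(C_i))`.  As printed: pull the partition back
to the coin cube along the monotone map ("all sets `A ∪ C_j` are closed upwards in the hypercube generated by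
`Y_i`'s") and apply Theorem 2.1 there (`prodBernoulli_strongHarris`).
[cite: Gladkov2024StrongFKG, Theorem 3.2 (proof, FUI case)] -/
theorem IsFUI.strongHarris {ν : Measure (Set W)} (h : IsFUI ν) {ι : Type*} (s : Finset ι)
    {A : Set (Set W)} {C : ι → Set (Set W)}
    (hdisj : ∀ i ∈ s, ∀ j ∈ s, i ≠ j → Disjoint (C i) (C j))
    (hdisjA : ∀ i ∈ s, Disjoint A (C i)) (hup : ∀ i ∈ s, IsUpperSet (A ∪ C i)) (hA : IsUpperSet A) :
    (∑ i ∈ s, ν.real (C i)) ^ 2 - ∑ i ∈ s, ν.real (C i) ^ 2 ≤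
      2 * (ν.real A * ν.real (A ∪ ⋃ i ∈ s, C i)ᶜ) := by
  obtain ⟨κ, _, q, Φ, hΦ, rfl⟩ := h
  have hm : Measurable Φ := Measurable.of_discrete
  have e : ∀ X : Set (Set W), ((prodBernoulli q).map Φ).real X = (prodBernoulli q).real (Φ ⁻¹' X) :=
    fun X => map_measureReal_apply hm MeasurableSet.of_discrete
  simp only [e]
  have hB : Φ ⁻¹' (A ∪ ⋃ i ∈ s, C i)ᶜ = ((Φ ⁻¹' A) ∪ ⋃ i ∈ s, Φ ⁻¹' (C i))ᶜ := by
    rw [Set.preimage_compl, Set.preimage_union, Set.preimage_iUnion₂]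
  rw [hB]
  exact prodBernoulli_strongHarris q s (fun i hi j hj hij => (hdisj i hi j hj hij).preimage Φ)
    (fun i hi => (hdisjA i hi).preimage Φ)
    (fun i hi => by rw [← Set.preimage_union]; exact (hup i hi).preimage hΦ) (hA.preimage hΦ)

/-- **Gladkov 2024, Theorem 3.2 (FKG+), UI case**: the same inequality for every UI law ("obtained as a limit of
inequalities for FUI measures"). [cite: Gladkov2024StrongFKG, Theorem 3.2] -/
theorem IsUI.strongHarris {ν : Measure (Set W)} (h : IsUI ν) {ι : Type*} (s : Finset ι)
    {A : Set (Set W)} {C : ι → Set (Set W)}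
    (hdisj : ∀ i ∈ s, ∀ j ∈ s, i ≠ j → Disjoint (C i) (C j))
    (hdisjA : ∀ i ∈ s, Disjoint A (C i)) (hup : ∀ i ∈ s, IsUpperSet (A ∪ C i)) (hA : IsUpperSet A) :
    (∑ i ∈ s, ν.real (C i)) ^ 2 - ∑ i ∈ s, ν.real (C i) ^ 2 ≤
      2 * (ν.real A * ν.real (A ∪ ⋃ i ∈ s, C i)ᶜ) := by
  obtain ⟨νs, hF, hlim⟩ := h
  have h1 : Tendsto (fun n => (∑ i ∈ s, (νs n).real (C i)) ^ 2 - ∑ i ∈ s, (νs n).real (C i) ^ 2) atTop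
      (𝓝 ((∑ i ∈ s, ν.real (C i)) ^ 2 - ∑ i ∈ s, ν.real (C i) ^ 2)) :=
    ((tendsto_finsetSum s fun i _ => hlim (C i)).pow 2).sub
      (tendsto_finsetSum s fun i _ => (hlim (C i)).pow 2)
  have h2 : Tendsto (fun n => 2 * ((νs n).real A * (νs n).real (A ∪ ⋃ i ∈ s, C i)ᶜ)) atTop
      (𝓝 (2 * (ν.real A * ν.real (A ∪ ⋃ i ∈ s, C i)ᶜ))) :=
    ((hlim A).mul (hlim _)).const_mul 2
  exact le_of_tendsto_of_tendsto' h1 h2 fun n => (hF n).strongHarris s hdisj hdisjA hup hA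

/-! ### Gladkov's Theorem 3.5: `µ_3` violates FKG+, hence is not UI -/

/-- Gladkov's `A = {|S| ≥ 2}` ("at least two fixed points"), as a family of subsets of `[3]`.
[cite: Gladkov2024StrongFKG, proof of Theorem 3.5] -/
def twoSet : Set (Set (Fin 3)) := {S | ∃ i j : Fin 3, i ≠ j ∧ i ∈ S ∧ j ∈ S}

/-- Gladkov's cells `C_i = {S = {i}}`. [cite: Gladkov2024StrongFKG, proof of Theorem 3.5] -/
def singleCell (i : Fin 3) : Set (Set (Fin 3)) := {{i}}

/-- `A` is closed upwards. [cite: Gladkov2024StrongFKG, proof of Theorem 3.5] -/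
theorem isUpperSet_twoSet : IsUpperSet twoSet := by
  rintro S T hST ⟨i, j, hij, hi, hj⟩
  exact ⟨i, j, hij, hST hi, hST hj⟩

/-- `A ∪ C_i = {S | S ⊇ {i}} ∪ {|S| ≥ 2}` is closed upwards: a superset of `{i}` is `{i}` or has two elements.
[cite: Gladkov2024StrongFKG, proof of Theorem 3.5] -/
theorem isUpperSet_twoSet_union_singleCell (i : Fin 3) : IsUpperSet (twoSet ∪ singleCell i) := by
  rintro S T hST (hS | hS)
  · exact Or.inl (isUpperSet_twoSet hST hS)
  · have hi : i ∈ T := hST (by rw [show S = {i} from hS]; exact rfl)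
    by_cases h : ∃ j, j ≠ i ∧ j ∈ T
    · obtain ⟨j, hji, hj⟩ := h
      exact Or.inl ⟨j, i, hji, hj, hi⟩
    · right
      have : T = {i} := by
        ext j
        refine ⟨fun hj => ?_, fun hj => by rw [Set.mem_singleton_iff.1 hj]; exact hi⟩
        by_contra hji
        exact h ⟨j, fun e => hji (Set.mem_singleton_iff.2 e), hj⟩
      exact this

/-- The cells are pairwise disjoint and disjoint from `A`. [cite: Gladkov2024StrongFKG, proof of Theorem 3.5] -/
theorem cells_disjoint :
    (∀ i ∈ (Finset.univ : Finset (Fin 3)), ∀ j ∈ (Finset.univ : Finset (Fin 3)), i ≠ j →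
      Disjoint (singleCell i) (singleCell j)) ∧
    ∀ i ∈ (Finset.univ : Finset (Fin 3)), Disjoint twoSet (singleCell i) := by
  constructor
  · intro i _ j _ hij
    rw [Set.disjoint_iff]
    rintro S ⟨hSi, hSj⟩
    have h1 : S = {i} := hSi
    have h2 : S = {j} := hSj
    exact hij (Set.singleton_eq_singleton_iff.1 (h1.symm.trans h2))
  · intro i _
    rw [Set.disjoint_iff]
    rintro S ⟨⟨a, b, hab, ha, hb⟩, hS⟩
    have h1 : S = {i} := hS
    rw [h1, Set.mem_singleton_iff] at ha hb
    exact hab (ha.trans hb.symm)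

/-- The values: `µ_3(A) = 1/6` (only `{1,2,3}`), `µ_3(C_i) = 1/6`, and `µ_3(B) = µ_3(∅) = 1/3` for the complement
`B = (A ∪ ⋃ C_i)ᶜ = {S = ∅}`. [cite: Gladkov2024StrongFKG, proof of Theorem 3.5] -/
theorem mu3_real_cells :
    mu3.real twoSet = 1/6 ∧ (∀ i : Fin 3, mu3.real (singleCell i) = 1/6) ∧
      mu3.real (twoSet ∪ ⋃ i ∈ (Finset.univ : Finset (Fin 3)), singleCell i)ᶜ = 1/3 := by
  have d : (0 : Fin 3) ≠ 1 ∧ (0 : Fin 3) ≠ 2 ∧ (1 : Fin 3) ≠ 2 := by decide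
  refine ⟨?_, ?_, ?_⟩
  · rw [mu3_real]
    have h0 : (∅ : Set (Fin 3)) ∉ twoSet := fun ⟨i, j, _, hi, _⟩ => hi
    have hs : ∀ k : Fin 3, ({k} : Set (Fin 3)) ∉ twoSet := fun k ⟨i, j, hij, hi, hj⟩ => by
      rw [Set.mem_singleton_iff] at hi hj; exact hij (hi.trans hj.symm)
    have hu : (univ : Set (Fin 3)) ∈ twoSet := ⟨0, 1, d.1, mem_univ _, mem_univ _⟩
    simp only [w3, h0, hs, hu, if_true, if_false]
    norm_num
  · intro i
    rw [mu3_real]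
    have h0 : (∅ : Set (Fin 3)) ∉ singleCell i := fun h => by
      have : (∅ : Set (Fin 3)) = {i} := h
      exact (Set.singleton_ne_empty i) this.symm
    have hu : (univ : Set (Fin 3)) ∉ singleCell i := fun h => by
      have h' : (univ : Set (Fin 3)) = {i} := h
      have : ((if i = 0 then 1 else 0 : Fin 3)) ∈ ({i} : Set (Fin 3)) := h' ▸ mem_univ _
      rw [Set.mem_singleton_iff] at this
      fin_cases i <;> simp at this
    have hs : ∀ k : Fin 3, (({k} : Set (Fin 3)) ∈ singleCell i ↔ k = i) := fun k =>
      ⟨fun h => Set.singleton_eq_singleton_iff.1 h, fun h => by rw [h]; rfl⟩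
    simp only [w3, h0, hu, hs, if_false]
    fin_cases i <;> simp
  · rw [mu3_real]
    set B := (twoSet ∪ ⋃ i ∈ (Finset.univ : Finset (Fin 3)), singleCell i)ᶜ with hB
    have h0 : (∅ : Set (Fin 3)) ∈ B := by
      simp only [hB, mem_compl_iff, mem_union, mem_iUnion, exists_prop, Finset.mem_univ, true_and, not_or,
        not_exists]
      exact ⟨fun ⟨i, j, _, hi, _⟩ => hi, fun k h => (Set.singleton_ne_empty k) (show (∅ : Set (Fin 3)) = {k} from h).symm⟩
    have hs : ∀ k : Fin 3, ({k} : Set (Fin 3)) ∉ B := fun k h => by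
      simp only [hB, mem_compl_iff, mem_union, mem_iUnion, exists_prop, Finset.mem_univ, true_and, not_or,
        not_exists] at h
      exact h.2 k rfl
    have hu : (univ : Set (Fin 3)) ∉ B := fun h => by
      simp only [hB, mem_compl_iff, mem_union, not_or] at h
      exact h.1 ⟨0, 1, d.1, mem_univ _, mem_univ _⟩
    simp only [w3, h0, hs, hu, if_true, if_false]
    norm_num

/-- **`µ_3` violates FKG+** ("`1/18 ≥ e_2(1/6,1/6,1/6) = 1/12`, a contradiction"): in the tree's `2e_2` form the
left side is `(1/2)² − 3/36 = 1/6` and the right side `2 · (1/6)(1/3) = 1/9`.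
[cite: Gladkov2024StrongFKG, proof of Theorem 3.5] -/
theorem mu3_violates_strongHarris :
    ¬ ((∑ i ∈ (Finset.univ : Finset (Fin 3)), mu3.real (singleCell i)) ^ 2 -
        ∑ i ∈ (Finset.univ : Finset (Fin 3)), mu3.real (singleCell i) ^ 2 ≤
      2 * (mu3.real twoSet * mu3.real (twoSet ∪ ⋃ i ∈ (Finset.univ : Finset (Fin 3)), singleCell i)ᶜ)) := by
  obtain ⟨hA, hC, hB⟩ := mu3_real_cells
  simp only [hC, hA, hB, Finset.sum_const, Finset.card_univ, Fintype.card_fin, nsmul_eq_mul]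
  norm_num

/-- **Gladkov 2024, Theorem 3.5: `µ_3` is not UI** — it is not a limit of laws of monotone functions of finitely
many independent coins (else FKG+ would hold for it). [cite: Gladkov2024StrongFKG, Theorem 3.5] -/
theorem mu3_not_isUI : ¬ IsUI mu3 := fun h =>
  mu3_violates_strongHarris (h.strongHarris Finset.univ cells_disjoint.1 cells_disjoint.2
    (fun i _ => isUpperSet_twoSet_union_singleCell i) isUpperSet_twoSet)

/-- In particular `µ_3` is not FUI (Kahn's Corollary 4 again, now through FKG+ rather than Theorem 2).
[cite: Gladkov2024StrongFKG, Theorem 3.4 and Theorem 3.5] -/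
theorem mu3_not_isFUI : ¬ IsFUI mu3 := fun h => mu3_not_isUI h.isUI

/-- **Kahn's Question 1 ("Are all PA measures UI?") has a NEGATIVE answer** (Gladkov 2024, Theorem 3.5: "There
are measures on `H_n` with positive associations which are not UI"): Kahn's `µ_3` — the fixed-point law of a
uniform permutation of three letters — is a positively associated probability measure on `2^{[3]}` that is not a
limit of FUI laws.  Consequently the implication "Question 1 for `µ_3` ⇒ Sahi's conjecture is false" of
[Kahn2022, p. 3] has a false premise. [cite: Gladkov2024StrongFKG, Theorem 3.5; Kahn2022, Question 1 (p. 2) and p. 3] -/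
theorem question1_negative :
    ∃ μ : Measure (Set (Fin 3)), IsProbabilityMeasure μ ∧ IsPositivelyAssociated μ ∧ ¬ IsUI μ :=
  ⟨mu3, isProbabilityMeasure_mu3, isPositivelyAssociated_mu3, mu3_not_isUI⟩

/-! ### FKG measures are FUI laws (Kahn's footnote 1 / Gladkov's Prop. 3.1 at measure level) -/

section FKG

open Literature.Probability.Percolation (prodBernoulli_real_eq_sum_weight_ind)
open Literature.Probability.Percolation.BHK2006 (weight)
open Literature.Probability.Percolation.DecisionTree (ind ind_of_mem ind_of_not_mem)

open Classical in
/-- Boolean coordinates of a subset of `Fin m` (the cube `2^{[m]}` as `Fin m → Bool`).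
[cite: Kahn2022, p. 2 footnote 1 (b)] -/
def setCube (m : ℕ) : Set (Fin m) ≃ (Fin m → Bool) where
  toFun S i := decide (i ∈ S)
  invFun y := {i | y i = true}
  left_inv S := by ext i; simp
  right_inv y := by funext i; simp

/-- Membership read off the Boolean coordinates. [cite: Kahn2022, p. 2 footnote 1 (b)] -/
theorem setCube_apply_eq_true_iff {m : ℕ} (S : Set (Fin m)) (i : Fin m) : setCube m S i = true ↔ i ∈ S := by
  classical
  show decide (i ∈ S) = true ↔ i ∈ S
  rw [decide_eq_true_eq]

/-- `setCube` is monotone. [cite: Kahn2022, p. 2 footnote 1 (b)] -/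
theorem setCube_mono (m : ℕ) : Monotone (setCube m) := by
  intro S T hST i
  exact Bool.le_iff_imp.2 fun h => by
    rw [setCube_apply_eq_true_iff] at h ⊢
    exact hST h

/-- The point masses of `prodBernoulli p` on a finite index type are the product weights
`bernoulliWeight p S = Π_{i∈S} p_i Π_{i∉S} (1 − p_i)`. [cite: Sahi2008, eq. (2) (p. 210)] -/
theorem prodBernoulli_real_singleton_eq_bernoulliWeight {ι : Type*} [Fintype ι] (p : ι → unitInterval)
    (S : Set ι) : (prodBernoulli p).real {S} = bernoulliWeight p S := by
  classical
  rw [prodBernoulli_real_eq_sum_weight_ind, Finset.sum_eq_single S]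
  · rw [ind_of_mem (Set.mem_singleton S), mul_one]
  · intro T _ hT
    rw [ind_of_not_mem (fun h => hT (Set.mem_singleton_iff.1 h)), mul_zero]
  · intro h; exact (h (Finset.mem_univ S)).elim

/-- In Boolean coordinates the product weight is `coinWeight`. [cite: Kahn2022, p. 2 footnote 1 (b)] -/
theorem bernoulliWeight_eq_coinWeight_setCube {m : ℕ} (q : Fin m → ℝ) (hq : ∀ i, 0 ≤ q i ∧ q i ≤ 1)
    (T : Set (Fin m)) :
    bernoulliWeight (fun i => (⟨q i, (hq i).1, (hq i).2⟩ : unitInterval)) T = coinWeight q (setCube m T) := by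
  classical
  show weight _ T = coinWeight q (setCube m T)
  unfold Literature.Probability.Percolation.BHK2006.weight coinWeight
  refine Finset.prod_congr rfl fun i _ => ?_
  have h1 : setCube m T i = true ↔ i ∈ T := setCube_apply_eq_true_iff T i
  by_cases h : i ∈ T
  · rw [if_pos h, if_pos (h1.2 h)]
  · rw [if_neg h, if_neg (mt h1.1 h)]

/-- **FKG measures are FUI laws** (Kahn's footnote 1; Gladkov's Proposition 3.1 "All measures `µ` with the FKG
property are FUI"), at measure level: if the point weights `S ↦ ν{S}` of a finite measure `ν` on `2^W` form an
FKG probability weight, then `ν` is the image of a non-degenerate product measure on a finite cube under a monotone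
map.  The weight-level representation `IsFKGMeasure.exists_coinRepresentation` read through `setCube`.
[cite: Kahn2022, p. 2 footnote 1; Gladkov2024StrongFKG, Prop. 3.1] -/
theorem isFUI_of_isFKGMeasure (ν : Measure (Set W)) [IsFiniteMeasure ν]
    (hν : IsFKGMeasure (fun S : Set W => ν.real {S})) : IsFUI ν := by
  classical
  obtain ⟨m, q, G, hq, hG, hrep⟩ := hν.exists_coinRepresentation
  have hq' : ∀ i, 0 ≤ q i ∧ q i ≤ 1 := fun i => ⟨(hq i).1.le, (hq i).2.le⟩
  let q₁ : Fin m → unitInterval := fun i => ⟨q i, (hq' i).1, (hq' i).2⟩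
  refine ⟨Fin m, inferInstance, q₁, G ∘ setCube m, hG.comp (setCube_mono m), ?_⟩
  have hΦ : Measurable (G ∘ setCube m) := Measurable.of_discrete
  -- equality of the real point masses
  have hreal : ∀ S : Set W, ν.real {S} = ((prodBernoulli q₁).map (G ∘ setCube m)).real {S} := by
    intro S
    rw [map_measureReal_apply hΦ MeasurableSet.of_discrete,
      show ν.real {S} = pushWeight (coinWeight q) G S from congrFun hrep S, pushWeight_apply,
      prodBernoulli_real_eq_sum_weight_ind, ← (setCube m).symm.sum_comp]
    refine Finset.sum_congr rfl fun y _ => ?_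
    have hTy : setCube m ((setCube m).symm y) = y := (setCube m).apply_symm_apply y
    by_cases h : G y = S
    · rw [if_pos h, ind_of_mem (show (setCube m).symm y ∈ (G ∘ setCube m) ⁻¹' {S} by
        rw [Set.mem_preimage, Function.comp_apply, hTy]; exact h), mul_one]
      have e := bernoulliWeight_eq_coinWeight_setCube q hq' ((setCube m).symm y)
      rw [hTy] at e
      exact e.symm
    · rw [if_neg h, ind_of_not_mem (show (setCube m).symm y ∉ (G ∘ setCube m) ⁻¹' {S} by
        rw [Set.mem_preimage, Function.comp_apply, hTy]; exact h), mul_zero]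
  refine Measure.ext_of_singleton fun S => ?_
  rw [← ENNReal.ofReal_toReal (measure_ne_top ν {S}),
    ← ENNReal.ofReal_toReal (measure_ne_top ((prodBernoulli q₁).map (G ∘ setCube m)) {S})]
  exact congrArg ENNReal.ofReal (hreal S)

/-- FKG measures are UI. [cite: Kahn2022, p. 2 footnote 1; Gladkov2024StrongFKG, Prop. 3.1 ("and therefore UI")] -/
theorem isUI_of_isFKGMeasure (ν : Measure (Set W)) [IsFiniteMeasure ν]
    (hν : IsFKGMeasure (fun S : Set W => ν.real {S})) : IsUI ν :=
  (isFUI_of_isFKGMeasure ν hν).isUI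

/-- Product measures on a finite cube are FUI laws (their point weights are FKG:
`isFKGMeasure_bernoulliWeight`). [cite: Kahn2022, p. 2 ("Underlying independents")] -/
theorem isFUI_prodBernoulli (p : W → unitInterval) : IsFUI (prodBernoulli p) := by
  refine isFUI_of_isFKGMeasure _ ?_
  have h : (fun S : Set W => (prodBernoulli p).real {S}) = bernoulliWeight p :=
    funext (prodBernoulli_real_singleton_eq_bernoulliWeight p)
  rw [h]
  exact isFKGMeasure_bernoulliWeight p

/-- **Gladkov 2024, Theorem 3.2 for FKG measures** ("In particular, it holds for all measures with the FKG
property"): the strong FKG inequality `ν(A)ν(B) ≥ e_2(ν(C_i))` (tree form `(Σ ν(C_i))² − Σ ν(C_i)² ≤ 2ν(A)ν(B)`,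
`B = (A ∪ ⋃ C_i)ᶜ`) for every finite measure on `2^W` whose point weights satisfy the FKG lattice condition.
[cite: Gladkov2024StrongFKG, Theorem 3.2 and the sentence before it] -/
theorem strongHarris_of_isFKGMeasure (ν : Measure (Set W)) [IsFiniteMeasure ν]
    (hν : IsFKGMeasure (fun S : Set W => ν.real {S})) {ι : Type*} (s : Finset ι)
    {A : Set (Set W)} {C : ι → Set (Set W)}
    (hdisj : ∀ i ∈ s, ∀ j ∈ s, i ≠ j → Disjoint (C i) (C j))
    (hdisjA : ∀ i ∈ s, Disjoint A (C i)) (hup : ∀ i ∈ s, IsUpperSet (A ∪ C i)) (hA : IsUpperSet A) :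
    (∑ i ∈ s, ν.real (C i)) ^ 2 - ∑ i ∈ s, ν.real (C i) ^ 2 ≤
      2 * (ν.real A * ν.real (A ∪ ⋃ i ∈ s, C i)ᶜ) :=
  (isFUI_of_isFKGMeasure ν hν).strongHarris s hdisj hdisjA hup hA

end FKG

/-! ### "Sahi's Conjecture … also implies (4) when `µ` is UI" (Kahn, p. 3) -/

section SahiTransfer

/-- `E₃` of a monotone image is `E₃` of the preimages. [cite: Kahn2022, p. 3; LiebSahi2021, eq. (2.1)] -/
theorem sahiE3_map {κ : Type*} [Fintype κ] (q : κ → unitInterval) (Φ : Set κ → Set W) (A B C : Set (Set W)) :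
    sahiE3 ((prodBernoulli q).map Φ) A B C = sahiE3 (prodBernoulli q) (Φ ⁻¹' A) (Φ ⁻¹' B) (Φ ⁻¹' C) := by
  have hm : Measurable Φ := Measurable.of_discrete
  have e : ∀ X : Set (Set W), ((prodBernoulli q).map Φ).real X = (prodBernoulli q).real (Φ ⁻¹' X) :=
    fun X => map_measureReal_apply hm MeasurableSet.of_discrete
  simp only [sahiE3_def, e, Set.preimage_inter]

/-- **Kahn, p. 3, FUI case**: if Sahi's third-order inequality (4) holds for all increasing events under every
product measure on a finite cube (Kahn's Conjecture 5 — a HYPOTHESIS here), then it holds for all increasing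
events under every FUI law. [cite: Kahn2022, p. 3 ("which of course also implies (4) when µ is UI")] -/
theorem IsFUI.sahiE3_nonneg_of_forall_prodBernoulli {ν : Measure (Set W)} (h : IsFUI ν)
    (hC5 : ∀ (κ : Type) [Fintype κ] (q : κ → unitInterval) (A B C : Set (Set κ)),
      IsUpperSet A → IsUpperSet B → IsUpperSet C → 0 ≤ sahiE3 (prodBernoulli q) A B C)
    {A B C : Set (Set W)} (hA : IsUpperSet A) (hB : IsUpperSet B) (hC : IsUpperSet C) :
    0 ≤ sahiE3 ν A B C := by
  obtain ⟨κ, _, q, Φ, hΦ, rfl⟩ := h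
  rw [sahiE3_map]
  exact hC5 κ q _ _ _ (hA.preimage hΦ) (hB.preimage hΦ) (hC.preimage hΦ)

/-- **Kahn, p. 3: "Sahi's Conjecture—which of course also implies (4) when `µ` is UI"**: the same for every UI
law, by passing to the limit in the (polynomial) expression `E₃`. [cite: Kahn2022, p. 3] -/
theorem IsUI.sahiE3_nonneg_of_forall_prodBernoulli {ν : Measure (Set W)} (h : IsUI ν)
    (hC5 : ∀ (κ : Type) [Fintype κ] (q : κ → unitInterval) (A B C : Set (Set κ)),
      IsUpperSet A → IsUpperSet B → IsUpperSet C → 0 ≤ sahiE3 (prodBernoulli q) A B C)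
    {A B C : Set (Set W)} (hA : IsUpperSet A) (hB : IsUpperSet B) (hC : IsUpperSet C) :
    0 ≤ sahiE3 ν A B C := by
  obtain ⟨νs, hF, hlim⟩ := h
  have ht : Tendsto (fun n => sahiE3 (νs n) A B C) atTop (𝓝 (sahiE3 ν A B C)) := by
    simp only [sahiE3_def]
    exact ((((hlim _).const_mul 2).add (((hlim A).mul (hlim B)).mul (hlim C))).sub
      ((((hlim A).mul (hlim _)).add ((hlim B).mul (hlim _))).add ((hlim C).mul (hlim _))))
  exact ge_of_tendsto' ht fun n => (hF n).sahiE3_nonneg_of_forall_prodBernoulli hC5 hA hB hC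

end SahiTransfer

end Kahn2022

end Literature.Combinatorics.Sahi2008
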